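import Mathlib.Analysis.SpecialFunctions.Gaussian.FourierTransform
import Mathlib.Analysis.SpecialFunctions.ImproperIntegrals
import Mathlib.MeasureTheory.Integral.Gamma
import Mathlib.Analysis.Calculus.MeanValue
import HarnessLib

/-!
# Gaussian integrals for Laplace's method on the heat ray

Trunk T-ANT (`Literature/NumberTheory/LFunctions`). Everything here is proved; the file is
elementary real analysis with no number theory, isolated from `XiHeatRayLaplace.lean` (the
Laplace-method step of the in-tree proof of `Literature.NumberTheory.LFunctions.ki_kim_lee_finite`, Ki–Kim–Lee 2009, Thm. 1.3)
to keep that file focused. Contents: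

* `Literature.NumberTheory.LFunctions.norm_cexp_sub_one_le_mul_exp` — `‖e^z − 1‖ ≤ ‖z‖ e^{‖z‖}`;
* `Literature.NumberTheory.LFunctions.abs_exp_neg_sub_exp_neg_le` — `|e^{-a} − e^{-b}| ≤ |a − b|` for `a, b ≥ 0`;
* `Literature.NumberTheory.LFunctions.integral_gaussian_phase` — `∫_ℝ e^{-y²/t + iθy} dy = √(πt) e^{-θ²t/4}` (`t > 0`), and its
  translate `Literature.NumberTheory.LFunctions.integral_gaussian_phase_sub`;
* `Literature.NumberTheory.LFunctions.integral_exp_neg_sq_div` — `∫_ℝ e^{-y²/c} dy = √(πc)`;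
* `Literature.NumberTheory.LFunctions.integral_abs_mul_exp_neg_sq_div` — `∫_ℝ |y| e^{-y²/c} dy = c`;
* `Literature.NumberTheory.LFunctions.integral_Iic_exp_neg_sq_div_le` — the one-sided tail `∫_{y ≤ −R} e^{-y²/t} dy ≤ (t/R) e^{-R²/t}`.

## References

* D. H. J. Polymath, Res. Math. Sci. 6 (2019) 31, §9 (the same Gaussian bookkeeping).
-/

noncomputable section

open Complex Filter Topology Set MeasureTheory
open scoped Real

namespace Literature.NumberTheory.LFunctions

/-! ## Two exponential inequalities -/

/-- **`‖e^z − 1‖ ≤ ‖z‖ e^{‖z‖}`** (mean value inequality for `s ↦ e^{sz}` on `[0, 1]`). [folklore] -/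
theorem norm_cexp_sub_one_le_mul_exp (z : ℂ) : ‖cexp z - 1‖ ≤ ‖z‖ * Real.exp ‖z‖ := by
  set f : ℝ → ℂ := fun s ↦ cexp (s * z) with hf
  have hderiv : ∀ s : ℝ, HasDerivAt f (cexp (s * z) * z) s := by
    intro s
    have h1 : HasDerivAt (fun w : ℂ ↦ cexp (w * z)) (cexp (s * z) * z) (s : ℂ) := by
      have hi : HasDerivAt (fun w : ℂ ↦ w * z) z (s : ℂ) := by
        simpa using (hasDerivAt_id (s : ℂ)).mul_const z
      simpa using hi.cexp
    exact h1.comp_ofReal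
  have hbound : ∀ s ∈ Ico (0:ℝ) 1, ‖cexp (s * z) * z‖ ≤ ‖z‖ * Real.exp ‖z‖ := by
    intro s hs
    rw [norm_mul, Complex.norm_exp, mul_comm]
    gcongr
    calc ((s : ℂ) * z).re ≤ ‖(s : ℂ) * z‖ := Complex.re_le_norm _
      _ = |s| * ‖z‖ := by rw [norm_mul, Complex.norm_real, Real.norm_eq_abs]
      _ ≤ 1 * ‖z‖ := by
          gcongr; rw [abs_of_nonneg hs.1]; exact hs.2.le
      _ = ‖z‖ := one_mul _
  have h := norm_image_sub_le_of_norm_deriv_le_segment'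
    (fun s _ ↦ (hderiv s).hasDerivWithinAt) hbound 1 (right_mem_Icc.2 zero_le_one)
  simpa [hf] using h

/-- **`|e^{-a} − e^{-b}| ≤ |a − b|` for `a, b ≥ 0`** (`exp` is `1`-Lipschitz on `(−∞, 0]`).
[folklore] -/
theorem abs_exp_neg_sub_exp_neg_le {a b : ℝ} (ha : 0 ≤ a) (hb : 0 ≤ b) :
    |Real.exp (-a) - Real.exp (-b)| ≤ |a - b| := by
  -- one-sided bound: `e^y − e^x ≤ |y − x|` for `x, y ≤ 0`
  have key : ∀ x y : ℝ, y ≤ 0 → Real.exp y - Real.exp x ≤ |y - x| := by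
    intro x y hy
    have h1 : x - y + 1 ≤ Real.exp (x - y) := Real.add_one_le_exp _
    have h2 : Real.exp x = Real.exp y * Real.exp (x - y) := by rw [← Real.exp_add]; ring_nf
    have hy1 : Real.exp y ≤ 1 := Real.exp_le_one_iff.2 hy
    have hy0 : 0 < Real.exp y := Real.exp_pos y
    have h3 : Real.exp y - Real.exp x ≤ Real.exp y * (y - x) := by
      rw [h2]; nlinarith
    rcases le_or_gt 0 (y - x) with h | h
    · calc Real.exp y - Real.exp x ≤ Real.exp y * (y - x) := h3
        _ ≤ 1 * (y - x) := mul_le_mul_of_nonneg_right hy1 h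
        _ = |y - x| := by rw [one_mul, abs_of_nonneg h]
    · have : Real.exp y * (y - x) ≤ 0 := mul_nonpos_of_nonneg_of_nonpos hy0.le h.le
      linarith [abs_nonneg (y - x)]
  rw [abs_le]
  constructor
  · have := key (-a) (-b) (by linarith)
    rw [show -b - -a = a - b by ring] at this
    linarith [abs_sub_comm a b]
  · have := key (-b) (-a) (by linarith)
    rw [show -a - -b = -(a - b) by ring, abs_neg] at this
    linarith

/-! ## Gaussian integrals with a linear phase -/

/-- **`∫_ℝ e^{-y²/t + iθy} dy = √(πt) e^{-θ² t/4}`** for `t > 0` and real `θ`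
(Mathlib's `integral_cexp_quadratic`). [folklore] -/
theorem integral_gaussian_phase {t : ℝ} (ht : 0 < t) (θ : ℝ) :
    ∫ y : ℝ, cexp (-((y ^ 2 / t : ℝ) : ℂ) + ((θ * y : ℝ) : ℂ) * I) =
      ((Real.sqrt (π * t) * Real.exp (-(θ ^ 2 * t / 4)) : ℝ) : ℂ) := by
  have hb : (-((1 / t : ℝ) : ℂ)).re < 0 := by
    simp only [neg_re, ofReal_re, neg_lt_zero]; positivity
  have h := integral_cexp_quadratic hb (θ * I) 0
  have e1 : (fun x : ℝ ↦ cexp (-((1 / t : ℝ) : ℂ) * x ^ 2 + θ * I * x + 0)) =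
      fun y : ℝ ↦ cexp (-((y ^ 2 / t : ℝ) : ℂ) + ((θ * y : ℝ) : ℂ) * I) := by
    funext y
    congr 1
    push_cast
    ring
  rw [e1] at h
  rw [h]
  have ht' : (t : ℂ) ≠ 0 := by exact_mod_cast ht.ne'
  have e2 : (π : ℂ) / - -((1 / t : ℝ) : ℂ) = ((π * t : ℝ) : ℂ) := by
    push_cast
    field_simp
  have e3 : (0 : ℂ) - (θ * I) ^ 2 / (4 * -((1 / t : ℝ) : ℂ)) = ((-(θ ^ 2 * t / 4) : ℝ) : ℂ) := by
    push_cast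
    field_simp
    ring_nf
    rw [I_sq]
    ring
  have e4 : ((π * t : ℝ) : ℂ) ^ (1 / 2 : ℂ) = ((Real.sqrt (π * t) : ℝ) : ℂ) := by
    rw [Real.sqrt_eq_rpow, Complex.ofReal_cpow (by positivity)]
    norm_num
  rw [e2, e3, e4, ← Complex.ofReal_exp, ← Complex.ofReal_mul]

/-- The translate: `∫_ℝ e^{-(u−c)²/t + iθ(u−c)} du = √(πt) e^{-θ² t/4}`. [folklore] -/
theorem integral_gaussian_phase_sub {t : ℝ} (ht : 0 < t) (θ c : ℝ) :
    ∫ u : ℝ, cexp (-(((u - c) ^ 2 / t : ℝ) : ℂ) + ((θ * (u - c) : ℝ) : ℂ) * I) =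
      ((Real.sqrt (π * t) * Real.exp (-(θ ^ 2 * t / 4)) : ℝ) : ℂ) := by
  have h := integral_sub_right_eq_self (μ := (volume : Measure ℝ))
    (fun y : ℝ ↦ cexp (-((y ^ 2 / t : ℝ) : ℂ) + ((θ * y : ℝ) : ℂ) * I)) c
  rw [← integral_gaussian_phase ht θ, ← h]

/-- The norm of the phase-Gaussian integrand: `‖e^{-y²/t + iθy + ρ}‖ = e^{-y²/t + Re ρ}`. [folklore] -/
theorem norm_cexp_gaussian_phase (t θ y : ℝ) (ρ : ℂ) :
    ‖cexp (-((y ^ 2 / t : ℝ) : ℂ) + ((θ * y : ℝ) : ℂ) * I + ρ)‖ = Real.exp (-(y ^ 2 / t) + ρ.re) := by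
  rw [Complex.norm_exp]
  congr 1
  simp only [add_re, neg_re, ofReal_re, mul_re, I_re, mul_zero, ofReal_im, I_im, mul_one,
    sub_self, add_zero]

/-! ## Real Gaussian integrals -/

/-- `∫_ℝ e^{-y²/c} dy = √(πc)` for `c > 0`. [folklore] -/
theorem integral_exp_neg_sq_div {c : ℝ} (hc : 0 < c) :
    ∫ y : ℝ, Real.exp (-(y ^ 2 / c)) = Real.sqrt (π * c) := by
  have h := integral_gaussian (1 / c)
  have e : (fun x : ℝ ↦ Real.exp (-(1 / c) * x ^ 2)) = fun y : ℝ ↦ Real.exp (-(y ^ 2 / c)) := by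
    funext y; congr 1; ring
  rw [e] at h
  rw [h]
  congr 1
  field_simp

/-- `y ↦ e^{-y²/c}` is integrable for `c > 0`. [folklore] -/
theorem integrable_exp_neg_sq_div {c : ℝ} (hc : 0 < c) :
    Integrable fun y : ℝ ↦ Real.exp (-(y ^ 2 / c)) := by
  have h := integrable_exp_neg_mul_sq (b := 1 / c) (by positivity)
  refine h.congr (Eventually.of_forall fun y ↦ ?_)
  simp only; congr 1; ring

/-- `y ↦ |y| e^{-y²/c}` is integrable for `c > 0`. [folklore] -/
theorem integrable_abs_mul_exp_neg_sq_div {c : ℝ} (hc : 0 < c) :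
    Integrable fun y : ℝ ↦ |y| * Real.exp (-(y ^ 2 / c)) := by
  have h := (integrable_mul_exp_neg_mul_sq (b := 1 / c) (by positivity)).norm
  refine h.congr (Eventually.of_forall fun y ↦ ?_)
  simp only [norm_mul, Real.norm_eq_abs, abs_of_pos (Real.exp_pos _)]
  congr 2; ring

/-- **`∫_ℝ |y| e^{-y²/c} dy = c`** for `c > 0` (`= 2 ∫_0^∞ y e^{-y²/c} dy`). [folklore] -/
theorem integral_abs_mul_exp_neg_sq_div {c : ℝ} (hc : 0 < c) :
    ∫ y : ℝ, |y| * Real.exp (-(y ^ 2 / c)) = c := by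
  have h1 : ∫ y : ℝ, |y| * Real.exp (-(y ^ 2 / c)) =
      2 * ∫ y in Ioi (0:ℝ), y * Real.exp (-(y ^ 2 / c)) := by
    have := integral_comp_abs (f := fun y : ℝ ↦ y * Real.exp (-(y ^ 2 / c)))
    simp only [sq_abs] at this
    exact this
  have h2 : ∫ y in Ioi (0:ℝ), y * Real.exp (-(y ^ 2 / c)) = c / 2 := by
    have h := _root_.integral_rpow_mul_exp_neg_mul_rpow (p := 2) (q := 1) (b := 1 / c) (by norm_num)
      (by norm_num) (by positivity)
    have e : (fun x : ℝ ↦ x ^ (1:ℝ) * Real.exp (-(1 / c) * x ^ (2:ℝ))) =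
        fun y : ℝ ↦ y * Real.exp (-(y ^ 2 / c)) := by
      funext y
      rw [Real.rpow_one, show (2:ℝ) = ((2:ℕ):ℝ) by norm_num, Real.rpow_natCast]
      congr 1; ring
    rw [e] at h
    rw [h]
    have e2 : (-(1 + 1) / 2 : ℝ) = -1 := by norm_num
    have e3 : ((1 + 1) / 2 : ℝ) = 1 := by norm_num
    rw [e2, e3, Real.Gamma_one, Real.rpow_neg_one]
    field_simp
  rw [h1, h2]; ring

/-- **One-sided Gaussian tail**: for `t, R > 0`, `∫_{y ≤ −R} e^{-y²/t} dy ≤ (t/R) e^{-R²/t}`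
(`e^{-y²/t} ≤ e^{Ry/t}` for `y ≤ −R`). [folklore] -/
theorem integral_Iic_exp_neg_sq_div_le {t R : ℝ} (ht : 0 < t) (hR : 0 < R) :
    ∫ y in Iic (-R), Real.exp (-(y ^ 2 / t)) ≤ t / R * Real.exp (-(R ^ 2 / t)) := by
  have hRt : 0 < R / t := by positivity
  have h1 : ∫ y in Iic (-R), Real.exp (-(y ^ 2 / t)) ≤ ∫ y in Iic (-R), Real.exp (R / t * y) := by
    refine setIntegral_mono_on (integrable_exp_neg_sq_div ht).integrableOn
      (integrableOn_exp_mul_Iic hRt _) measurableSet_Iic fun y hy ↦ ?_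
    apply Real.exp_le_exp.2
    have hy' : y ≤ -R := hy
    rw [show R / t * y = -((R * -y) / t) by ring, neg_le_neg_iff]
    apply div_le_div_of_nonneg_right _ ht.le
    nlinarith
  refine h1.trans (le_of_eq ?_)
  rw [integral_exp_mul_Iic hRt]
  field_simp

end Literature.NumberTheory.LFunctions

end
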